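import Literature.IUT.HodgeTheaters.InitialThetaDataDecompositionCharacters
import Literature.IUT.HodgeTheaters.InitialThetaDataLocalConjugacy
import Literature.NumberTheory.GaloisRepresentations.AbsIntegersEquiv
import Literature.NumberTheory.GaloisRepresentations.DecompositionGroupOfCompletion
import Literature.AnabelianGeometry.AbsoluteAnabelian.NFDecompositionRelSlimProofs
import HarnessLib

/-!
# [IUTchI] Def. 3.1 (e): the decomposition group `G_v̲ ⊆ G_K ⊆ G_F = Gal(F̄/F)` has TRIVIAL CENTRALIZER in `G_F`
# (`Z_{G_F}(G_v̲) = 1`, [AbsAnab] Thm. 1.1.1 (ii) read at abc-iut's Def. 3.1 (e) datum) — the `hZ` binder of the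
# Ex. 4.4 (ii) / Ex. 4.5 (i) geometric-ambiguity theorem (p496228) DISCHARGED (proof-only)

`Proofs` companion (theorems only: no `def`, no `instance`, no notation, no `Prop` fact, no `sorry`) for the cell abc-iut, layer
L5, seat abc-iut-L5-t3 (gen 10), self-row «HZ-DECOMPAT-RELSLIM» (= gen-9 standing ask (b), 2026-08-27T04:50:08Z).

S. Mochizuki, *Inter-universal Teichmüller theory I*, Def. 3.1 (e) (kurims May-2020 manuscript pp. 62–63) [claim: Mochizuki2012,
status: disputed]: «the decomposition group `G_v ⊆ G_K := Gal(F̄/K)` determined, up to `G_K`-conjugacy, by `v`»; Example 4.4 (ii)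
p. 107 / Example 4.5 (i) (the outer action on `Π_v̲` and its ambiguity).  S. Mochizuki, *The absolute anabelian geometry of hyperbolic
curves* [AbsAnab] (2004), Theorem 1.1.1 (ii) p. 6: for a number field `F` and a nonarchimedean prime `𝔭` of `F̄` the inclusion
`G_𝔭 ↪ G_F` is relatively slim — FACT-LIST F-0029 `galoisNF_decomposition_relativelySlim`, PROVED in the tree
(`galoisNF_decomposition_relativelySlim_holds`, abc-iut-w5-d231; engine `centralizer_image_decompositionSubgroup_eq_bot` of the GalRep
trunk over `galoisMLF_slim_holds`) [cite: MochizukiAbsAnab2004, Thm 1.1.1 (ii) p.6].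

In the tree the [IUTchI] Def. 3.1 (e) decomposition group at an index `v̲` of the copy of `V̲` over a finite place `w` of `K` is
abc-iut-L5-t4's `InitialThetaData.decompAt v̲ = decompositionSubgroupGF F K_w ι` (abc-iut-L5-t2 `InitialThetaDataLocalGalois`): the image of
`Gal(K̄_w/K_w) → Gal(F̄/K) ⊆ Gal(F̄/F)` along a chosen `K`-embedding `ι : F̄ → K̄_w`, for the ABSTRACT algebraic closure `F̄` of
Def. 3.1 (a).  abc-iut-L5-t3's Ex. 4.4 (ii) / 4.5 (i) theorem `outerAction_compatible_geometricAmbiguity_thetaOfBadPairs` (p496228)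
carried the displayed binder `hZ : Z_{G_F}(G_K ∩ G_v̲) = 1` («[AbsAnab] Thm 1.1.1 (ii) instance, not discharged»).  This file DISCHARGES it:

* §0 `centralizer_eq_bot_of_injective_of_image` — centralizer-triviality pulls back along an injective homomorphism.
* §1 (GalRep level, `AlgebraicClosure F` / `AlgebraicClosure K`) `exists_isOpen_le_range_absGaloisRestrict` — for number fields `F ⊆ K`
  the image of `Γ_K → Γ_F` contains an OPEN subgroup of `Γ_F` (the fixing subgroup of the finite subextension `e⁻¹(K)` for the bijective
  chosen embedding `e : \bar F → K̄`); **`centralizer_range_absGaloisRestrict_comp_adicCompletion_eq_bot`** — the image of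
  `Γ_{K_w} → Γ_K → Γ_F` has trivial centralizer in `Γ_F`: it is `D_𝔓(F) ∩ res(Γ_K)` for the prime `𝔓` of `\bar ℤ_F` below the prime
  `𝔓₀` of `\bar ℤ_K` cut out by `K̄ → \bar K_w` (GalRep `decompositionSubgroup_adicCompletionPrime_eq_range` = Neukirch II (9.6), and
  `comap_decompositionSubgroup_comap_absIntegersMap`), hence contains an OPEN subgroup of `D_𝔓(F)`, whose centralizer is trivial by F-0029.
* §2 (transport) **`centralizer_decompositionSubgroupGF_adicCompletion_eq_bot`** — for the abstract `F̄` ([IsAlgClosure F F̄], `K ⊆ F̄`) and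
  ANY `K`-embedding `ι : F̄ → \bar K_w`: `Z_{Gal(F̄/F)}(decompositionSubgroupGF F K_w ι) = 1` (transport along `F̄ ≃ₐ[K] K̄`
  (`isAlgClosure_of_isScalarTower`), the chosen `\bar F ≃ₐ[F] K̄`, abc-iut-L5-t2's `localToGlobal_unique` / `exists_localToGF_eq_conj`).
* §3 (at the initial Θ-data) **`InitialThetaData.centralizer_decompAt_eq_bot_of_indexCopyVal_eq_non` / `_of_mem_indexCopyBad`**,
  `galoisSubgroupOf_inf_decompAt_of_indexCopyVal_eq_non` (`G_K ∩ G_v̲ = G_v̲`), and **`centralizer_galoisSubgroupOf_inf_decompAt_eq_bot_of_…`**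
  = the `hZ` binder of p496228 VERBATIM (through its `gv_eq_galoisSubgroupOf_inf_decompAt`), now a theorem at every index over a finite
  place, in particular at every `v̲ ∈ V̲^bad`; `eq_one_of_forall_commute_decompAt`.

Universe: `F K F̄ : Type` (the universe of the kit of record and of the MLF slimness fact `galoisMLF_slim`).  HONEST FRAMING: classical
Galois theory ([AbsAnab] Thm 1.1.1 (ii) as PROVED in the tree) read on OUR typed Def. 3.1 (e) objects; binder ≠ fact — here the binder
becomes a theorem; no token of the cone moves by this file alone; nothing here asserts that abc is proved or refuted or takes a side on
[IUTchIII] Cor. 3.12; typed ≠ inhabited ≠ discharged.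

## References
* [Mochizuki2012] S. Mochizuki, IUT I, Def. 3.1 (e) pp. 62–63, Ex. 4.4 (ii) p. 107. [claim: Mochizuki2012, status: disputed]
* [MochizukiAbsAnab2004] S. Mochizuki, *The absolute anabelian geometry of hyperbolic curves* (2004), Thm. 1.1.1 (ii) p. 6.
* [NeukirchANT1999] J. Neukirch, *Algebraic Number Theory* (1999), Ch. II §9 Prop. (9.6), Ch. IV §1.
-/

noncomputable section

namespace Literature.IUT.HodgeTheaters

open scoped Pointwise
open _root_.Field _root_.IsDedekindDomain _root_.NumberField Literature.NumberTheory.GaloisRepresentations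
  Literature.AnabelianGeometry.AbsoluteAnabelian

/-! ### §0. Centralizer-triviality pulls back along an injective homomorphism -/

section Pullback

variable {G H : Type*} [Group G] [Group H]

/-- If `f : G → H` is an injective homomorphism and the centralizer in `H` of `f '' S` is trivial, then the centralizer
in `G` of `S` is trivial. [cite: MochizukiAbsAnab2004, Thm 1.1.1 (ii) p.6] -/
theorem centralizer_eq_bot_of_injective_of_image (f : G →* H) (hf : Function.Injective f) (S : Set G)
    (h : Subgroup.centralizer (f '' S) = ⊥) : Subgroup.centralizer S = ⊥ := by
  rw [eq_bot_iff]
  intro z hz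
  rw [Subgroup.mem_bot, ← map_eq_one_iff f hf, ← Subgroup.mem_bot, ← h, Subgroup.mem_centralizer_iff]
  rintro _ ⟨s, hs, rfl⟩
  rw [← map_mul, ← map_mul, (Subgroup.mem_centralizer_iff.mp hz) s hs]

end Pullback

/-! ### §1. GalRep level: the image of `Γ_{K_w} → Γ_K → Γ_F` has trivial centralizer in `Γ_F` -/

section GalRep

variable (F K : Type) [Field F] [NumberField F] [Field K] [NumberField K] [Algebra F K]

/-- **An OPEN subgroup of `Γ_F` inside the image of `Γ_K → Γ_F`** (`K/F` finite): the fixing subgroup of the finite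
subextension of `F̄/F` corresponding to `K` under the (bijective) chosen embedding `F̄ → K̄`.
[cite: NeukirchANT1999, Ch. IV §1] -/
theorem exists_isOpen_le_range_absGaloisRestrict :
    ∃ V : Subgroup (absoluteGaloisGroup F), IsOpen (V : Set (absoluteGaloisGroup F)) ∧
      V ≤ (absGaloisRestrict F K).toMonoidHom.range := by
  haveI : Module.Finite F K := Module.Finite.of_restrictScalars_finite ℚ F K
  letI := absClosureAlgebra F K
  haveI := absClosure_isScalarTower F K
  haveI : Algebra.IsAlgebraic (AlgebraicClosure F) (AlgebraicClosure K) :=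
    Algebra.IsAlgebraic.tower_top (K := F) (AlgebraicClosure F)
  have hbij := IsAlgClosed.algebraMap_bijective_of_isIntegral (k := AlgebraicClosure F) (K := AlgebraicClosure K)
  -- the chosen embedding `ι : F̄ → K̄` as an `F`-isomorphism
  let e : AlgebraicClosure F ≃ₐ[F] AlgebraicClosure K := AlgEquiv.ofBijective (absClosureEmbedding F K) hbij
  have he : ∀ x, e x = absClosureEmbedding F K x := fun _ => rfl
  -- `K` read inside `F̄`
  let φ : K →ₐ[F] AlgebraicClosure F := e.symm.toAlgHom.comp (IsScalarTower.toAlgHom F K (AlgebraicClosure K))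
  let E : IntermediateField F (AlgebraicClosure F) := φ.fieldRange
  haveI : FiniteDimensional F E := by
    have : Module.Finite F (LinearMap.range φ.toLinearMap) := inferInstance
    exact this
  refine ⟨(E.fixingSubgroup : Subgroup (AlgebraicClosure F ≃ₐ[F] AlgebraicClosure F)), E.fixingSubgroup_isOpen, ?_⟩
  intro g hg
  -- `σ := e ∘ g ∘ e⁻¹` is `K`-linear because `g` fixes `E = e⁻¹(K)`
  have hgE : ∀ k : K, (absoluteGaloisGroup.toAlgEquiv F g) (e.symm (algebraMap K (AlgebraicClosure K) k)) =
      e.symm (algebraMap K (AlgebraicClosure K) k) := fun k =>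
    (IntermediateField.mem_fixingSubgroup_iff _ _).mp hg _ ⟨k, rfl⟩
  let σr : AlgebraicClosure K ≃+* AlgebraicClosure K :=
    e.symm.toRingEquiv.trans ((absoluteGaloisGroup.toAlgEquiv F g).toRingEquiv.trans e.toRingEquiv)
  have hσr : ∀ y, σr y = e (absoluteGaloisGroup.toAlgEquiv F g (e.symm y)) := fun _ => rfl
  let σ : AlgebraicClosure K ≃ₐ[K] AlgebraicClosure K := AlgEquiv.ofRingEquiv (f := σr) fun k => by
    rw [hσr, hgE, AlgEquiv.apply_symm_apply]
  refine ⟨(absoluteGaloisGroup.toAlgEquiv K).symm σ, ?_⟩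
  change absGaloisRestrict F K _ = g
  refine FaithfulSMul.eq_of_smul_eq_smul (α := AlgebraicClosure F) fun x => ?_
  apply (absClosureEmbedding F K).injective
  change absClosureEmbedding F K (_ • x) = absClosureEmbedding F K (g • x)
  rw [absGaloisRestrict_apply_smul, absoluteGaloisGroup.toAlgEquiv_symm_apply, AlgEquiv.ofRingEquiv_apply, hσr,
    ← he, ← he, AlgEquiv.symm_apply_apply]
  rfl

variable (w : HeightOneSpectrum (𝓞 K))

/-- **The image of `Γ_{K_w} → Γ_K → Γ_F` has trivial centralizer in `Γ_F`** (`F ⊆ K` number fields, `w` a finite place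
of `K`): that image is `D_𝔓(F) ∩ Γ_K` for the prime `𝔓` of `\bar ℤ_F` below the prime `𝔓₀` of `\bar ℤ_K` cut out by `K̄ → \bar K_w`
(Neukirch II (9.6): `D_{𝔓₀}(K) = res(Γ_{K_w})`; `res⁻¹(D_𝔓(F)) = D_{𝔓₀}(K)`), hence contains the open subgroup `D_𝔓(F) ∩ V` of
`D_𝔓(F)` for any open `V ⊆ Γ_K`-image, whose centralizer is trivial by the relative slimness of `D_𝔓(F) ↪ Γ_F`
([AbsAnab] Thm 1.1.1 (ii), `centralizer_image_decompositionSubgroup_eq_bot`). [cite: MochizukiAbsAnab2004, Thm 1.1.1 (ii) p.6] -/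
theorem centralizer_range_absGaloisRestrict_comp_adicCompletion_eq_bot :
    Subgroup.centralizer ((((absGaloisRestrict F K).toMonoidHom.comp
      (absGaloisRestrict K (w.adicCompletion K)).toMonoidHom).range : Subgroup (absoluteGaloisGroup F)) :
        Set (absoluteGaloisGroup F)) = ⊥ := by
  haveI : Module.Finite F K := Module.Finite.of_restrictScalars_finite ℚ F K
  obtain ⟨V, hVopen, hVle⟩ := exists_isOpen_le_range_absGaloisRestrict F K
  let 𝔔 : Ideal (absIntegers (𝓞 K) K) := adicCompletionPrime K w
  let 𝔓 : Ideal (absIntegers (𝓞 F) F) := 𝔔.comap (absIntegersMap F K)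
  let u : HeightOneSpectrum (𝓞 F) := w.under (𝓞 F)
  have h𝔓u : 𝔓 ∈ u.primesAbove :=
    comap_absIntegersMap_mem_primesAbove (K := F) (M := K) (v := u) (w := w) rfl (adicCompletionPrime_mem_primesAbove K w)
  have hD : (𝔓.decompositionSubgroup (absoluteGaloisGroup F)).comap (absGaloisRestrict F K).toMonoidHom =
      𝔔.decompositionSubgroup (absoluteGaloisGroup K) :=
    comap_decompositionSubgroup_comap_absIntegersMap F K 𝔔
  have h𝔔 : 𝔔.decompositionSubgroup (absoluteGaloisGroup K) = (absGaloisRestrict K (w.adicCompletion K)).toMonoidHom.range :=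
    decompositionSubgroup_adicCompletionPrime_eq_range K w
  let U : Subgroup (𝔓.decompositionSubgroup (absoluteGaloisGroup F)) :=
    V.comap (𝔓.decompositionSubgroup (absoluteGaloisGroup F)).subtype
  have hU : IsOpen (U : Set (𝔓.decompositionSubgroup (absoluteGaloisGroup F))) := hVopen.preimage continuous_subtype_val
  have hZ := centralizer_image_decompositionSubgroup_eq_bot F u
    (centralizer_eq_bot_of_isOpen_absoluteGaloisGroup_adicCompletion u) h𝔓u U hU
  have hsub : (𝔓.decompositionSubgroup (absoluteGaloisGroup F)).subtype '' (U : Set _) ⊆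
      ((((absGaloisRestrict F K).toMonoidHom.comp (absGaloisRestrict K (w.adicCompletion K)).toMonoidHom).range :
        Subgroup (absoluteGaloisGroup F)) : Set (absoluteGaloisGroup F)) := by
    rintro _ ⟨⟨g, hgD⟩, hgV, rfl⟩
    obtain ⟨γ, rfl⟩ := hVle hgV
    have hγ : γ ∈ 𝔔.decompositionSubgroup (absoluteGaloisGroup K) := by rw [← hD]; exact hgD
    rw [h𝔔] at hγ
    obtain ⟨σ, rfl⟩ := hγ
    exact ⟨σ, rfl⟩
  rw [eq_bot_iff, ← hZ]
  exact Subgroup.centralizer_le hsub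

end GalRep

/-! ### §2. Transport to an ABSTRACT algebraic closure `F̄` of `F` containing `K` ([IUTchI] Def 3.1 (a)(c)(e)) -/

section AlgClosure

variable (F : Type) {K Fbar : Type} [Field F] [Field K] [Algebra F K] [Field Fbar] [Algebra F Fbar] [Algebra K Fbar]
  [IsScalarTower F K Fbar] [IsAlgClosure F Fbar]

/-- `F̄` is an algebraic closure of `K` as well (`K/F` algebraic). [cite: NeukirchANT1999, Ch. IV §1] -/
theorem isAlgClosure_of_isScalarTower [Algebra.IsAlgebraic F K] : IsAlgClosure K Fbar where
  isAlgClosed := IsAlgClosure.isAlgClosed F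
  isAlgebraic := Algebra.IsAlgebraic.tower_top (K := F) K

end AlgClosure

section Transport

variable (F : Type) {K Fbar : Type} [Field F] [NumberField F] [Field K] [NumberField K] [Algebra F K]
  [Field Fbar] [Algebra F Fbar] [Algebra K Fbar] [IsScalarTower F K Fbar] [IsAlgClosure F Fbar] [Normal K Fbar]
  (w : HeightOneSpectrum (𝓞 K))

/-- **The decomposition group `G_w ⊆ G_K ⊆ G_F = Gal(F̄/F)` of [IUTchI] Def. 3.1 (e) has TRIVIAL CENTRALIZER in `G_F`**, for the
abstract algebraic closure `F̄` of Def. 3.1 (a), ANY `K`-embedding `ι : F̄ → ar K_w` and the completion `K_w` at any finite place `w`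
of `K`: `Z_{G_F}(G_w) = 1` — [AbsAnab] Thm 1.1.1 (ii) (relative slimness, FACT-LIST F-0029, PROVED in the tree) read on abc-iut-L5-t2's
`decompositionSubgroupGF` by transport along `F̄ ≃ₐ[K] K̄`, `ar F ≃ₐ[F] K̄` and the `G_K`-conjugacy of two embeddings.
[cite: MochizukiAbsAnab2004, Thm 1.1.1 (ii) p.6] -/
theorem centralizer_decompositionSubgroupGF_adicCompletion_eq_bot
    (ι : Fbar →ₐ[K] AlgebraicClosure (w.adicCompletion K)) :
    Subgroup.centralizer (decompositionSubgroupGF F (w.adicCompletion K) ι : Set (Fbar ≃ₐ[F] Fbar)) = ⊥ := by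
  haveI : Module.Finite F K := Module.Finite.of_restrictScalars_finite ℚ F K
  haveI : IsAlgClosure K Fbar := isAlgClosure_of_isScalarTower F
  -- `θK : F̄ ≃ₐ[K] K̄`, the chosen `e : \bar F ≃ₐ[F] K̄`, and `θF := e⁻¹ ∘ θK : F̄ ≃ₐ[F] \bar F`
  let θK : Fbar ≃ₐ[K] AlgebraicClosure K := IsAlgClosure.equiv K Fbar (AlgebraicClosure K)
  letI := absClosureAlgebra F K
  haveI := absClosure_isScalarTower F K
  haveI : Algebra.IsAlgebraic (AlgebraicClosure F) (AlgebraicClosure K) :=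
    Algebra.IsAlgebraic.tower_top (K := F) (AlgebraicClosure F)
  have hbij := IsAlgClosed.algebraMap_bijective_of_isIntegral (k := AlgebraicClosure F) (K := AlgebraicClosure K)
  let e : AlgebraicClosure F ≃ₐ[F] AlgebraicClosure K := AlgEquiv.ofBijective (absClosureEmbedding F K) hbij
  have he : ∀ x, e x = absClosureEmbedding F K x := fun _ => rfl
  let θF : Fbar ≃ₐ[F] AlgebraicClosure F := (θK.restrictScalars F).trans e.symm
  have hθF : ∀ x, θF x = e.symm (θK x) := fun _ => rfl
  have hθF' : ∀ y, θF.symm y = θK.symm (e y) := fun _ => rfl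
  -- the convenient embedding `ι' := ι₀ ∘ θK`
  let ι' : Fbar →ₐ[K] AlgebraicClosure (w.adicCompletion K) :=
    (absClosureEmbedding K (w.adicCompletion K)).comp (θK : Fbar →ₐ[K] AlgebraicClosure K)
  have hι' : ∀ x, ι' x = absClosureEmbedding K (w.adicCompletion K) (θK x) := fun _ => rfl
  -- Step 1: restriction along `ι'` is the `θK`-conjugate of `res : Γ_{K_w} → Γ_K`
  have h1 : ∀ σ : absoluteGaloisGroup (w.adicCompletion K),
      localToGlobal (w.adicCompletion K) ι' (absoluteGaloisGroup.toAlgEquiv _ σ) =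
        θK.trans ((absoluteGaloisGroup.toAlgEquiv K (absGaloisRestrict K (w.adicCompletion K) σ)).trans θK.symm) := by
    intro σ
    symm
    refine localToGlobal_unique (w.adicCompletion K) ι' fun x => ?_
    rw [hι', hι', AlgEquiv.trans_apply, AlgEquiv.trans_apply, AlgEquiv.apply_symm_apply,
      ← absoluteGaloisGroup.smul_def, ← absoluteGaloisGroup.smul_def, absGaloisRestrict_apply_smul]
  -- Step 2: conjugation by `θF`, a group isomorphism `Gal(F̄/F) ≃* Γ_F`
  let c : (Fbar ≃ₐ[F] Fbar) →* absoluteGaloisGroup F :=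
    (absoluteGaloisGroup.toAlgEquiv F).symm.toMonoidHom.comp θF.autCongr.toMonoidHom
  have hc : ∀ g y, c g • y = θF (g (θF.symm y)) := fun _ _ => rfl
  have hc_inj : Function.Injective c :=
    (absoluteGaloisGroup.toAlgEquiv F).symm.injective.comp θF.autCongr.injective
  -- Step 3: `c ∘ localToGF ι' = res_{F,K} ∘ res_{K,K_w}`
  have h3 : ∀ σ : absoluteGaloisGroup (w.adicCompletion K),
      c (localToGF F (w.adicCompletion K) ι' (absoluteGaloisGroup.toAlgEquiv _ σ)) =
        absGaloisRestrict F K (absGaloisRestrict K (w.adicCompletion K) σ) := by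
    intro σ
    refine FaithfulSMul.eq_of_smul_eq_smul (α := AlgebraicClosure F) fun y => ?_
    apply (absClosureEmbedding F K).injective
    change absClosureEmbedding F K (_ • y) = absClosureEmbedding F K (_ • y)
    rw [absGaloisRestrict_apply_smul, hc, ← he, ← he, hθF, hθF', AlgEquiv.apply_symm_apply]
    change θK (localToGlobal (w.adicCompletion K) ι' (absoluteGaloisGroup.toAlgEquiv _ σ) (θK.symm (e y))) = _
    rw [h1, AlgEquiv.trans_apply, AlgEquiv.trans_apply, AlgEquiv.apply_symm_apply, AlgEquiv.apply_symm_apply,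
      absoluteGaloisGroup.smul_def]
  -- Step 4: transport of the GalRep-level statement along `c`
  have h4 : Subgroup.centralizer (decompositionSubgroupGF F (w.adicCompletion K) ι' : Set (Fbar ≃ₐ[F] Fbar)) = ⊥ := by
    refine centralizer_eq_bot_of_injective_of_image c hc_inj _ ?_
    have himg : (c : (Fbar ≃ₐ[F] Fbar) → absoluteGaloisGroup F) ''
        (decompositionSubgroupGF F (w.adicCompletion K) ι' : Set (Fbar ≃ₐ[F] Fbar)) =
        ((((absGaloisRestrict F K).toMonoidHom.comp (absGaloisRestrict K (w.adicCompletion K)).toMonoidHom).range :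
          Subgroup (absoluteGaloisGroup F)) : Set (absoluteGaloisGroup F)) := by
      ext g
      simp only [Set.mem_image, SetLike.mem_coe, decompositionSubgroupGF, MonoidHom.mem_range, MonoidHom.coe_comp,
        Function.comp_apply, ContinuousMonoidHom.coe_toMonoidHom]
      constructor
      · rintro ⟨_, ⟨σa, rfl⟩, rfl⟩
        exact ⟨(absoluteGaloisGroup.toAlgEquiv _).symm σa, (h3 _).symm⟩
      · rintro ⟨σ, rfl⟩
        exact ⟨_, ⟨absoluteGaloisGroup.toAlgEquiv _ σ, rfl⟩, h3 σ⟩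
    rw [himg]
    exact centralizer_range_absGaloisRestrict_comp_adicCompletion_eq_bot F K w
  -- Step 5: any other embedding gives a `G_K`-conjugate decomposition group
  obtain ⟨τ, -, hτ⟩ := exists_localToGF_eq_conj F (w.adicCompletion K) ι' ι
  refine centralizer_eq_bot_of_injective_of_image (MulAut.conj τ).toMonoidHom (MulAut.conj τ).injective _ ?_
  have himg : ((MulAut.conj τ).toMonoidHom : (Fbar ≃ₐ[F] Fbar) → (Fbar ≃ₐ[F] Fbar)) ''
      (decompositionSubgroupGF F (w.adicCompletion K) ι : Set (Fbar ≃ₐ[F] Fbar)) =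
      (decompositionSubgroupGF F (w.adicCompletion K) ι' : Set (Fbar ≃ₐ[F] Fbar)) := by
    ext g
    simp only [Set.mem_image, SetLike.mem_coe, decompositionSubgroupGF, MonoidHom.mem_range, MulEquiv.coe_toMonoidHom,
      MulAut.conj_apply]
    constructor
    · rintro ⟨_, ⟨σ, rfl⟩, rfl⟩
      exact ⟨σ, by rw [hτ σ]; group⟩
    · rintro ⟨σ, rfl⟩
      exact ⟨_, ⟨σ, rfl⟩, by rw [hτ σ]; group⟩
  rw [himg]
  exact h4

end Transport

/-! ### §3. At the initial Θ-data: `Z_{G_F}(G_v̲) = 1` for every index `v̲` over a finite place -/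

section Datum

variable {F K Fbar : Type} [Field F] [NumberField F] [Field K] [NumberField K] [Algebra F K]
  [Field Fbar] [Algebra F Fbar] [Algebra K Fbar] {E : WeierstrassCurve F} [E.IsElliptic] {l : ℕ}
  {Pb : BadPlacePredicates K} (D : InitialThetaData F K Fbar E l Pb)

namespace InitialThetaData

/-- **`Z_{G_F}(G_v̲) = 1` at every index over a finite place** — the decomposition group `D.decompAt v̲` of abc-iut-L5-t4's place data
(image of `Gal(K̄_w/K_w) → G_F` along the chosen embedding) has trivial centralizer in `G_F = Gal(F̄/F)`: [AbsAnab] Thm 1.1.1 (ii)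
(relative slimness of `G_𝔭 ↪ G_F`, FACT-LIST F-0029, PROVED) at our Def. 3.1 (e) datum. ([IUTchI] Def 3.1 (e) p.62) [claim: Mochizuki2012, status: disputed] -/
theorem centralizer_decompAt_eq_bot_of_indexCopyVal_eq_non {v : D.IndexCopy} {w : FinitePlace K}
    (h : D.indexCopyVal v = Val.non w) : Subgroup.centralizer (D.decompAt v : Set (Fbar ≃ₐ[F] Fbar)) = ⊥ := by
  rw [D.decompAt_of_indexCopyVal_eq_non h]
  haveI := D.isScalarTower
  haveI := D.normal_K
  haveI := D.isAlgClosure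
  exact centralizer_decompositionSubgroupGF_adicCompletion_eq_bot F (FinitePlace.maximalIdeal w) _

/-- **`Z_{G_F}(G_v̲) = 1` at every BAD index** (`V̲^bad ⊆ V̲^non`). ([IUTchI] Def 3.1 (e) p.62) [claim: Mochizuki2012, status: disputed] -/
theorem centralizer_decompAt_eq_bot_of_mem_indexCopyBad {v : D.IndexCopy} (hv : v ∈ D.indexCopyBad) :
    Subgroup.centralizer (D.decompAt v : Set (Fbar ≃ₐ[F] Fbar)) = ⊥ := by
  obtain ⟨w, hw⟩ := D.exists_indexCopyVal_eq_non_of_mem_indexCopyBad hv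
  exact D.centralizer_decompAt_eq_bot_of_indexCopyVal_eq_non hw

/-- `G_v̲ ⊆ G_K`, so `G_K ∩ G_v̲ = G_v̲`, at an index over a finite place. ([IUTchI] Def 3.1 (e) p.62) [claim: Mochizuki2012, status: disputed] -/
theorem galoisSubgroupOf_inf_decompAt_of_indexCopyVal_eq_non {v : D.IndexCopy} {w : FinitePlace K}
    (h : D.indexCopyVal v = Val.non w) : galoisSubgroupOf F K Fbar ⊓ D.decompAt v = D.decompAt v := by
  refine inf_eq_right.mpr ?_
  rw [D.decompAt_of_indexCopyVal_eq_non h]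
  haveI := D.isScalarTower
  haveI := D.normal_K
  exact decompositionSubgroupGF_le F _ _

/-- **`Z_{G_F}(G_K ∩ G_v̲) = 1`** — VERBATIM the displayed binder `hZ` of abc-iut-L5-t3's
`outerAction_compatible_geometricAmbiguity_thetaOfBadPairs` (p496228, via `gv_eq_galoisSubgroupOf_inf_decompAt`), now a THEOREM at every
index over a finite place. ([IUTchI] Ex 4.4 (ii) p.107) [claim: Mochizuki2012, status: disputed] -/
theorem centralizer_galoisSubgroupOf_inf_decompAt_eq_bot_of_indexCopyVal_eq_non {v : D.IndexCopy} {w : FinitePlace K}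
    (h : D.indexCopyVal v = Val.non w) :
    Subgroup.centralizer ((galoisSubgroupOf F K Fbar ⊓ D.decompAt v : Subgroup (Fbar ≃ₐ[F] Fbar)) :
      Set (Fbar ≃ₐ[F] Fbar)) = ⊥ := by
  rw [D.galoisSubgroupOf_inf_decompAt_of_indexCopyVal_eq_non h]
  exact D.centralizer_decompAt_eq_bot_of_indexCopyVal_eq_non h

/-- **`Z_{G_F}(G_K ∩ G_v̲) = 1` at every BAD index** — the `hZ` binder of p496228 discharged where it is used.
([IUTchI] Ex 4.4 (ii) p.107) [claim: Mochizuki2012, status: disputed] -/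
theorem centralizer_galoisSubgroupOf_inf_decompAt_eq_bot_of_mem_indexCopyBad {v : D.IndexCopy} (hv : v ∈ D.indexCopyBad) :
    Subgroup.centralizer ((galoisSubgroupOf F K Fbar ⊓ D.decompAt v : Subgroup (Fbar ≃ₐ[F] Fbar)) :
      Set (Fbar ≃ₐ[F] Fbar)) = ⊥ := by
  obtain ⟨w, hw⟩ := D.exists_indexCopyVal_eq_non_of_mem_indexCopyBad hv
  exact D.centralizer_galoisSubgroupOf_inf_decompAt_eq_bot_of_indexCopyVal_eq_non hw

/-- **Slimness-type consequence used downstream: an element of `G_F` commuting with `G_v̲` is trivial.**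
([IUTchI] Def 3.1 (e) p.62) [claim: Mochizuki2012, status: disputed] -/
theorem eq_one_of_forall_commute_decompAt {v : D.IndexCopy} (hv : v ∈ D.indexCopyBad) {z : Fbar ≃ₐ[F] Fbar}
    (hz : ∀ g ∈ D.decompAt v, g * z = z * g) : z = 1 := by
  rw [← Subgroup.mem_bot, ← D.centralizer_decompAt_eq_bot_of_mem_indexCopyBad hv, Subgroup.mem_centralizer_iff]
  exact fun g hg => hz g hg

end InitialThetaData

end Datum

end Literature.IUT.HodgeTheaters

end
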